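import Literature.MathematicalPhysics.QuantumFieldTheory.Balaban1983to89.B6BlockHolderLipschitzV1
import Literature.MathematicalPhysics.QuantumFieldTheory.Balaban1983to89.B4TorusKernel

/-!
# `Balaban1983to89.B9TorusLabelDistanceToolkit` — T. Bałaban, *Propagators and renormalization transformations for lattice gauge theories. II*, Commun. Math.
# Phys. **96** (1984) 223–250 [Balaban1984PropagatorsII] (2.2) p. 224 (the torus distance of the collar axiom) and *Propagators for lattice gauge theories in a
# background field*, CMP **99** (1985) [Balaban1985BackgroundPropagators] p. 410 («U restricted to Ω₀(□) ⊂ □̃⁵»): the THREE torus distances of the tree —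
# `cdist` on residues (B3), `circAbs` on integer labels (B4 `MultiPeriod`), `supDist` on sites (lattice calculus) — COMPARED, with the triangle inequality and the
# one-step bounds the locality bookkeeping of NODE 00's local operators needs

statement-level skeleton of published theorems with citation tags; proofs where landed; nothing here is a claim about the Yang–Mills mass gap

WHY THIS FILE (cell context).  The (3.35) cover of `□̃(c)` (`B9Eq335CubeDomCoverP ∕ …WideP`, this seat) is phrased with `circAbs` on labels (r03∕p21's window lemma
is), the taxi-run geometry of def-Y's transporters (`B9Eq340TaxiTelescope.supDist_rungSites_taxiSteps_le`) with `supDist`, and lit-balaban r05's stencil reach with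
the real `torusSupNorm`; the readings-in-collar file (`B9DeltaALocalReadingsInCollarY`) needs them interchangeable.  [folklore] arithmetic of `ℤ∕N`; nothing of [B9].

WHAT IS PROVED (0 `def`): `cdist_sub_le_natAbs` (`cdist (a − b) ≤ |a.val − b.val|`), `cdist_add_le` (subadditivity), `cdist_sub_le_circAbs` and `circAbs_sub_le_cdist`
(`cdist (a − b) = circAbs N (a.val − b.val)` as two inequalities), `supDist_triangle` (torus sites, level `0`), `supDist_shift_le_one ∕ '`.
HONEST SCOPE.  Bookkeeping; count-neutral; nothing continuum ∕ OS ∕ mass gap ∕ Clay.  Cell `pub-ymgap` (HUMAN RULING D-0062), Track A node N06 [B9], seat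
`pub-ymgap-dag-n06-j` (harness re-seat gen 23), 2026-08-28.  NEW file; nothing landed is modified.  Net new unproved facts: 0.
-/

namespace Literature.MathematicalPhysics.QuantumFieldTheory.Balaban1983to89.B9TorusLabelDistanceToolkit

open Literature.MathematicalPhysics.QuantumFieldTheory.Balaban1983to89
open Literature.MathematicalPhysics.QuantumFieldTheory.Balaban1983to89.LatticeFieldCalculus (supDist)
open Literature.MathematicalPhysics.QuantumFieldTheory.Balaban1983to89.B3TorusRadialSums (cdist cdist_le_supDist cdist_neg supDist_comm)
open Literature.MathematicalPhysics.QuantumFieldTheory.Balaban1983to89.B6BlockHolderLipschitzV1 (supDist_le_of_cdist_le)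
open Literature.MathematicalPhysics.QuantumFieldTheory.Balaban1983to89.B4TorusKernel.MultiPeriod (circAbs)

/-! ## §1 Torus toolkit: `cdist` versus labels, the triangle inequality, one-step shifts -/

section Torus

variable {N : ℕ} [NeZero N]

/-- `cdist (a − b) ≤ |a.val − b.val|` (the torus distance is at most the label distance). [cite: Balaban1984PropagatorsII, (2.2) p.224 (torus distance; bookkeeping)] -/
theorem cdist_sub_le_natAbs (a b : ZMod N) : (cdist (a - b) : ℤ) ≤ |((a.val : ℤ)) - b.val| := by
  rcases le_or_gt b.val a.val with h | h
  · have e : (a - b).val = a.val - b.val := ZMod.val_sub h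
    have h1 : (cdist (a - b) : ℤ) ≤ ((a - b).val : ℤ) := by exact_mod_cast B3TorusRadialSums.cdist_le_val _
    rw [e, Nat.cast_sub h] at h1
    exact h1.trans (le_abs_self _)
  · have e : (b - a).val = b.val - a.val := ZMod.val_sub h.le
    have h1 : (cdist (a - b) : ℤ) ≤ ((-(a - b)).val : ℤ) := by exact_mod_cast B3TorusRadialSums.cdist_le_neg_val _
    rw [neg_sub, e, Nat.cast_sub h.le] at h1
    exact h1.trans (by rw [abs_sub_comm]; exact le_abs_self _)

/-- subadditivity of `cdist`. [cite: Balaban1982Higgs1, (1.3) p.604 (the torus distance; bookkeeping)] -/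
theorem cdist_add_le (a b : ZMod N) : cdist (a + b) ≤ cdist a + cdist b := by
  -- four cases on which of `a.val`, `(−a).val` and `b.val`, `(−b).val` realise the minima
  have key : ∀ p q : ZMod N, cdist (p + q) ≤ p.val + (-q).val := by
    intro p q
    rcases le_or_gt (-q).val p.val with h | h
    · have e : (p + q).val = p.val - (-q).val := by
        have : p + q = p - (-q) := by ring
        rw [this]; exact ZMod.val_sub h
      calc cdist (p + q) ≤ (p + q).val := B3TorusRadialSums.cdist_le_val _
        _ = p.val - (-q).val := e
        _ ≤ p.val + (-q).val := by omega
    · have e : (-(p + q)).val = (-q).val - p.val := by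
        have : -(p + q) = -q - p := by ring
        rw [this]; exact ZMod.val_sub h.le
      calc cdist (p + q) ≤ (-(p + q)).val := B3TorusRadialSums.cdist_le_neg_val _
        _ = (-q).val - p.val := e
        _ ≤ p.val + (-q).val := by omega
  unfold B3TorusRadialSums.cdist
  rcases le_total a.val (-a).val with ha | ha <;> rcases le_total b.val (-b).val with hb | hb
  · rw [min_eq_left ha, min_eq_left hb]
    calc min (a + b).val (-(a + b)).val ≤ (a + b).val := min_le_left _ _
      _ ≤ a.val + b.val := ZMod.val_add_le _ _
  · rw [min_eq_left ha, min_eq_right hb]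
    exact key a b
  · rw [min_eq_right ha, min_eq_left hb]
    have := key b a
    rw [add_comm] at this
    calc min (a + b).val (-(a + b)).val = cdist (a + b) := rfl
      _ ≤ b.val + (-a).val := this
      _ = (-a).val + b.val := add_comm _ _
  · rw [min_eq_right ha, min_eq_right hb]
    calc min (a + b).val (-(a + b)).val ≤ (-(a + b)).val := min_le_right _ _
      _ = (-a + -b).val := by rw [neg_add]
      _ ≤ (-a).val + (-b).val := ZMod.val_add_le _ _

/-- `cdist (a − b) ≤ circAbs N (a.val − b.val)`: the torus distance of two residues is at most the period-distance of their label difference (in fact equal;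
the inequality is what the stencil-reach conversion needs). [cite: Balaban1984PropagatorsII, (2.2) p.224 (torus distance; bookkeeping)] -/
theorem cdist_sub_le_circAbs (a b : ZMod N) : (cdist (a - b) : ℤ) ≤ circAbs N ((a.val : ℤ) - b.val) := by
  have hN : 0 < N := Nat.pos_of_ne_zero (NeZero.ne N)
  have ha : (a.val : ℤ) < N := by exact_mod_cast ZMod.val_lt a
  have hb : (b.val : ℤ) < N := by exact_mod_cast ZMod.val_lt b
  unfold B4TorusKernel.MultiPeriod.circAbs
  rcases le_or_gt b.val a.val with h | h
  · -- `t = a.val − b.val ∈ [0, N)`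
    have e1 : (a - b).val = a.val - b.val := ZMod.val_sub h
    have hmod : (((a.val : ℤ) - b.val) % (N : ℤ)) = (a.val : ℤ) - b.val :=
      Int.emod_eq_of_lt (by omega) (by omega)
    rw [hmod]
    refine le_min ?_ ?_
    · have : (cdist (a - b) : ℤ) ≤ ((a - b).val : ℤ) := by exact_mod_cast B3TorusRadialSums.cdist_le_val _
      rw [e1, Nat.cast_sub h] at this; exact this
    · have h2 : (cdist (a - b) : ℤ) ≤ ((-(a - b)).val : ℤ) := by exact_mod_cast B3TorusRadialSums.cdist_le_neg_val _
      rw [ZMod.neg_val] at h2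
      split_ifs at h2 with h0
      · -- `a = b`
        have hc : cdist (a - b) = 0 := by rw [h0]; exact (B3TorusRadialSums.cdist_eq_zero_iff _).2 rfl
        rw [hc]; push_cast; omega
      · rw [Nat.cast_sub (le_of_lt (ZMod.val_lt _)), e1, Nat.cast_sub h] at h2
        exact h2
  · -- `t = a.val − b.val ∈ (−N, 0)`
    have e1 : (b - a).val = b.val - a.val := ZMod.val_sub h.le
    have hmod : (((a.val : ℤ) - b.val) % (N : ℤ)) = (a.val : ℤ) - b.val + N := by
      have : ((a.val : ℤ) - b.val) % (N : ℤ) = ((a.val : ℤ) - b.val + N * 1) % N := (Int.add_mul_emod_self_left _ _ _).symm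
      rw [this, mul_one]
      exact Int.emod_eq_of_lt (by omega) (by omega)
    rw [hmod]
    refine le_min ?_ ?_
    · have hba : b - a ≠ 0 := fun h0 => by
        have hb' : b = a := sub_eq_zero.1 h0
        rw [hb'] at h; exact lt_irrefl _ h
      have e3 : (a - b).val = N - (b - a).val := by
        have e2 : a - b = -(b - a) := by ring
        rw [e2, ZMod.neg_val, if_neg hba]
      have h2 : (cdist (a - b) : ℤ) ≤ ((a - b).val : ℤ) := by exact_mod_cast B3TorusRadialSums.cdist_le_val _
      rw [e3, Nat.cast_sub (le_of_lt (ZMod.val_lt _)), e1, Nat.cast_sub h.le] at h2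
      linarith
    · have h2 : (cdist (a - b) : ℤ) ≤ ((-(a - b)).val : ℤ) := by exact_mod_cast B3TorusRadialSums.cdist_le_neg_val _
      rw [neg_sub, e1, Nat.cast_sub h.le] at h2
      linarith

/-- the converse bound: `circAbs N (a.val − b.val) ≤ cdist (a − b)` (so the two distances agree). [cite: Balaban1984PropagatorsII, (2.2) p.224 (torus distance; bookkeeping)] -/
theorem circAbs_sub_le_cdist (a b : ZMod N) : circAbs N ((a.val : ℤ) - b.val) ≤ (cdist (a - b) : ℤ) := by
  have hN : 0 < N := Nat.pos_of_ne_zero (NeZero.ne N)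
  have ha : (a.val : ℤ) < N := by exact_mod_cast ZMod.val_lt a
  have hb : (b.val : ℤ) < N := by exact_mod_cast ZMod.val_lt b
  unfold B4TorusKernel.MultiPeriod.circAbs B3TorusRadialSums.cdist
  rw [Nat.cast_min]
  rcases le_or_gt b.val a.val with h | h
  · have e1 : (a - b).val = a.val - b.val := ZMod.val_sub h
    have hmod : (((a.val : ℤ) - b.val) % (N : ℤ)) = (a.val : ℤ) - b.val :=
      Int.emod_eq_of_lt (by omega) (by omega)
    rw [hmod]
    rcases eq_or_lt_of_le h with heq | hlt
    · -- `a.val = b.val`: the left entry of the `min` is `0`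
      have h0 : (a.val : ℤ) - b.val = 0 := by rw [heq]; ring
      rw [h0]
      exact le_trans (min_le_left _ _) (by positivity)
    · have hab : a - b ≠ 0 := by
        intro h0
        have : a = b := sub_eq_zero.1 h0
        rw [this] at hlt; exact lt_irrefl _ hlt
      have e2 : (-(a - b)).val = N - (a - b).val := by rw [ZMod.neg_val, if_neg hab]
      rw [e2, e1, Nat.cast_sub (by omega : a.val - b.val ≤ N), Nat.cast_sub h]
  · have e1 : (b - a).val = b.val - a.val := ZMod.val_sub h.le
    have hmod : (((a.val : ℤ) - b.val) % (N : ℤ)) = (a.val : ℤ) - b.val + N := by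
      have : ((a.val : ℤ) - b.val) % (N : ℤ) = ((a.val : ℤ) - b.val + N * 1) % N := (Int.add_mul_emod_self_left _ _ _).symm
      rw [this, mul_one]
      exact Int.emod_eq_of_lt (by omega) (by omega)
    rw [hmod]
    have hba : b - a ≠ 0 := fun h0 => by
      have hb' : b = a := sub_eq_zero.1 h0
      rw [hb'] at h; exact lt_irrefl _ h
    have e3 : (a - b).val = N - (b - a).val := by
      have e2 : a - b = -(b - a) := by ring
      rw [e2, ZMod.neg_val, if_neg hba]
    rw [neg_sub, e3, e1, Nat.cast_sub (by omega : b.val - a.val ≤ N), Nat.cast_sub h.le]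
    apply le_of_eq
    congr 1 <;> ring

end Torus

section Lattice

variable {P : Params}

/-- the triangle inequality for the torus sup-distance. [cite: Balaban1982Higgs1, (1.3) p.604 (the torus distance), folklore] -/
theorem supDist_triangle (x y z : Site P 0) : supDist x z ≤ supDist x y + supDist y z := by
  haveI : NeZero (P.sitesPerDir 0) := NeZero.of_pos (lt_trans zero_lt_one (P.one_lt_sitesPerDir 0))
  refine supDist_le_of_cdist_le _ _ fun μ => ?_
  have e : x μ - z μ = (x μ - y μ) + (y μ - z μ) := by ring
  rw [e]
  exact (cdist_add_le _ _).trans (add_le_add (cdist_le_supDist x y μ) (cdist_le_supDist y z μ))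

/-- a site and its forward neighbour are at sup-distance `≤ 1`. [cite: Balaban1985BackgroundPropagators, (3.3) p.390 (bonds ⟨x, x+e_μ⟩), bookkeeping] -/
theorem supDist_shift_le_one (x : Site P 0) (μ : Fin P.d) : supDist x (x.shift μ) ≤ 1 := by
  haveI : NeZero (P.sitesPerDir 0) := NeZero.of_pos (lt_trans zero_lt_one (P.one_lt_sitesPerDir 0))
  refine supDist_le_of_cdist_le _ _ fun ν => ?_
  by_cases hν : ν = μ
  · subst hν
    have e : x ν - x.shift ν ν = -1 := by simp [Site.shift]
    rw [e, cdist_neg]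
    calc cdist (1 : ZMod (P.sitesPerDir 0)) ≤ (1 : ZMod (P.sitesPerDir 0)).val := B3TorusRadialSums.cdist_le_val _
      _ ≤ 1 := by rw [ZMod.val_one_eq_one_mod]; exact Nat.mod_le _ _
  · have e : x ν - x.shift μ ν = 0 := by simp [Site.shift, Function.update_of_ne hν]
    rw [e]
    simp [B3TorusRadialSums.cdist]

/-- … and symmetrically. [cite: Balaban1985BackgroundPropagators, (3.3) p.390, bookkeeping] -/
theorem supDist_shift_le_one' (x : Site P 0) (μ : Fin P.d) : supDist (x.shift μ) x ≤ 1 := by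
  rw [supDist_comm]; exact supDist_shift_le_one x μ

end Lattice

end Literature.MathematicalPhysics.QuantumFieldTheory.Balaban1983to89.B9TorusLabelDistanceToolkit
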